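import Mathlib
import Summits.Ventures.PercRepro2.Defs
import Summits.Ventures.PercRepro2.Graph
import Summits.Ventures.PercRepro2.OneColourSwitch
import Summits.Ventures.PercRepro2.RegionHubSign
import Summits.Ventures.PercRepro2.SideSwitch
import Summits.Ventures.PercRepro2.SideSwitchFibre
import Summits.Ventures.PercRepro2.SideSwitchClosed
import Summits.Ventures.PercRepro2.SideSwitchComps
import Summits.Ventures.PercRepro2.SideSwitchCompsFibre
import Summits.Ventures.PercRepro2.TermSwitchDefs
import Summits.Ventures.PercRepro2.TermSwitchFibre
import Summits.Ventures.PercRepro2.TermSwitchCompsFibre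
import Summits.Ventures.PercRepro2.TermSwitchMono
import Summits.Ventures.PercRepro2.TermSwitchM9
import Summits.Ventures.PercRepro2.M9NoPocketDefs
import Summits.Ventures.PercRepro2.M9NoPocketWorld
import Summits.Ventures.PercRepro2.M9NoPocketWorldD
import Summits.Ventures.PercRepro2.M9NoPocketCompl
import Summits.Ventures.PercRepro2.M9NoPocketM9
import Summits.Ventures.PercRepro2.M9DAvoid
import Summits.Ventures.PercRepro2.M9DAvoidSplit
import Summits.Ventures.PercRepro2.M9RegionSplit
import Summits.Ventures.PercRepro2.M9HarrisCube
import Summits.Ventures.PercRepro2.M9PocketCubeDefs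
import Summits.Ventures.PercRepro2.M9PocketCubeFibre
import Summits.Ventures.PercRepro2.M9PocketCubeMono
import Summits.Ventures.PercRepro2.M9PocketCubeHub
import Summits.Ventures.PercRepro2.M9PocketCubeWorldMono
import Summits.Ventures.PercRepro2.M9PocketCubeCompl
import Summits.Ventures.PercRepro2.M9PocketCubeHarrisY

/-!
# `m9` on the single-`d` class WITH a pocket — the theorem (blind cell PercRepro2, p3 g23,
2026-08-28; `proofs/P3-HARRIS.md`)

**Theorem** (`m9SignSum_nonpos_of_singleD_pocket`): for a finite marked multigraph and a
non-mark `d` such that every non-mark other than `d` is adjacent to `p` or `q` and `d` is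
adjacent to `r` and to `s`, `Σ_{Sep} σ_pq · σ_rs ≤ 0`.  Proof: `m9 = dSignSum` (every `Sep`
colouring is doubly reached only at `d`, `DOne_of_adj`); the `d`-avoiding split
`dSignSum = dSignSumAvoid − 2·eWSum` with `eWSum ≥ 0` (M9DAvoidSplit); the three-region identity
`dSignSumAvoid = regionL − 2·regionY` (M9RegionSplit); `regionY ≥ 0` by Harris on the block-group
cube (M9PocketCubeHarrisY); and `regionL ≤ 0` because the hub-free region is exactly the
`sepH ∧ DZeroH` set of the terminal set `{r, s, d}` (`hubfree_iff_sepH_dzeroH`) on which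
`σ̃_pq = σ_pq` (`sigma_endsD_eq_of_sepH`), so `regionL` is the side-switch sum
`dzeroSignSumH` of `{r, s, d}`, non-positive on every graph (`TermSwitch.dzeroSignSumH_nonpos_triple`,
p3 g21).  Own work; std axioms.
-/

namespace Summit.Ventures.PercRepro2

namespace NoPocket

open Finset Classical RegionHub OneColourSwitch SideSwitch TermSwitch

variable {V : Type*} {E : Type*}

section Triple

variable {ends : E → Sym2 V}

/-- Membership in the `Y`-world of the terminal set `{r, s, d}`. -/
lemma mem_KH_triple {r s d : V} {ω : Config E} {x : V} :
    x ∈ KH ends ({r, s, d} : Set V) ω ↔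
      Conn ends ω r x ∨ Conn ends ω s x ∨ Conn ends ω d x := by
  rw [mem_KH_iff]
  constructor
  · rintro ⟨h, hh, hc⟩
    simp only [Set.mem_insert_iff, Set.mem_singleton_iff] at hh
    rcases hh with rfl | rfl | rfl
    · exact Or.inl hc
    · exact Or.inr (Or.inl hc)
    · exact Or.inr (Or.inr hc)
  · rintro (hc | hc | hc)
    · exact ⟨r, by simp, hc⟩
    · exact ⟨s, by simp, hc⟩
    · exact ⟨d, by simp, hc⟩

/-- Membership in the `W`-world of the terminal set `{r, s, d}`. -/
lemma mem_MH_triple {r s d : V} {ω : Config E} {x : V} :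
    x ∈ MH ends ({r, s, d} : Set V) ω ↔
      Conn ends (OneColourSwitch.compl ω) r x ∨ Conn ends (OneColourSwitch.compl ω) s x ∨
        Conn ends (OneColourSwitch.compl ω) d x :=
  mem_KH_triple (ω := OneColourSwitch.compl ω)

/-- A mark `t ≠ d` separated from `{r, s}` and not reached from `d` by a hub edge lies outside
the `Y`-world of `{r, s, d}`. -/
lemma not_mem_KH_triple_of_hubfree {r s d : V} {ω : Config E} {t : V} (htd : t ≠ d)
    (htr : ¬ Conn ends ω t r) (hts : ¬ Conn ends ω t s)
    (hW : ¬ ∃ e u, ends e = s(d, u) ∧ ω e = true ∧ Conn (endsD ends d) ω u t) :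
    t ∉ KH ends ({r, s, d} : Set V) ω := by
  intro h
  rcases mem_KH_triple.1 h with hc | hc | hc
  · exact htr (conn_symm hc)
  · exact hts (conn_symm hc)
  · obtain ⟨e, u, hends, he, hcu⟩ := conn_d_decomp htd (conn_symm hc)
    exact hW ⟨e, u, hends, he, conn_symm hcu⟩

/-- **A hub-free `Sep` colouring is `sepH` for `{r, s, d}`.** -/
lemma sepH_of_hubfree {p q r s d : V} (hpd : p ≠ d) (hqd : q ≠ d) {ω : Config E}
    (hsep : sep2 ends p q r s ω) (hY : ¬ hubY ends d p q ω) (hW : ¬ hubW ends d p q ω) :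
    sepH ends p q ({r, s, d} : Set V) ω := by
  obtain ⟨⟨hpr, hps, hqr, hqs⟩, ⟨hpr', hps', hqr', hqs'⟩⟩ := hsep
  refine ⟨?_, ?_, ?_, ?_⟩
  · exact not_mem_KH_triple_of_hubfree hpd hpr hps
      (fun ⟨e, u, hends, he, hc⟩ => hY ⟨e, u, hends, he, Or.inl hc⟩)
  · exact not_mem_KH_triple_of_hubfree hqd hqr hqs
      (fun ⟨e, u, hends, he, hc⟩ => hY ⟨e, u, hends, he, Or.inr hc⟩)
  · exact not_mem_KH_triple_of_hubfree (ω := OneColourSwitch.compl ω) hpd hpr' hps'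
      (fun ⟨e, u, hends, he, hc⟩ => hW ⟨e, u, hends, he, Or.inl hc⟩)
  · exact not_mem_KH_triple_of_hubfree (ω := OneColourSwitch.compl ω) hqd hqr' hqs'
      (fun ⟨e, u, hends, he, hc⟩ => hW ⟨e, u, hends, he, Or.inr hc⟩)

/-- **Under the adjacency hypothesis, `sepH` for `{r, s, d}` gives `DZeroH`.** -/
lemma DZeroH_triple_of_adj {p q r s d : V}
    (hadj : ∀ x, Nonmark p q r s x → x ≠ d → ∃ e, ends e = s(x, p) ∨ ends e = s(x, q))
    {ω : Config E} (h : sepH ends p q ({r, s, d} : Set V) ω) :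
    DZeroH ends ({r, s, d} : Set V) ω := by
  obtain ⟨hpK, hqK, hpM, hqM⟩ := h
  intro x hx hK hM
  simp only [Set.mem_insert_iff, Set.mem_singleton_iff, not_or] at hx
  obtain ⟨hxr, hxs, hxd⟩ := hx
  by_cases hxp : x = p
  · subst hxp; exact hpK hK
  by_cases hxq : x = q
  · subst hxq; exact hqK hK
  obtain ⟨e, he⟩ := hadj x ⟨hxp, hxq, hxr, hxs⟩ hxd
  cases hc : ω e
  · rcases he with he | he
    · exact hpM (mem_MH_of_closed hM hc he)
    · exact hqM (mem_MH_of_closed hM hc he)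
  · rcases he with he | he
    · exact hpK (mem_KH_of_open hK hc he)
    · exact hqK (mem_KH_of_open hK hc he)

/-- **The hub-free region is the `sepH ∧ DZeroH` set of `{r, s, d}`.** -/
lemma hubfree_iff_sepH_dzeroH {p q r s d : V}
    (hadj : ∀ x, Nonmark p q r s x → x ≠ d → ∃ e, ends e = s(x, p) ∨ ends e = s(x, q))
    (hpd : p ≠ d) (hqd : q ≠ d) {ω : Config E} :
    (sep2 ends p q r s ω ∧ DOne ends r s d ω ∧ ¬ hubY ends d p q ω ∧ ¬ hubW ends d p q ω) ↔
      (sepH ends p q ({r, s, d} : Set V) ω ∧ DZeroH ends ({r, s, d} : Set V) ω) := by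
  constructor
  · rintro ⟨hsep, _, hY, hW⟩
    have hH := sepH_of_hubfree hpd hqd hsep hY hW
    exact ⟨hH, DZeroH_triple_of_adj hadj hH⟩
  · rintro ⟨hH, _⟩
    have hsep : sep2 ends p q r s ω := sep2_of_sepH (by simp) (by simp) hH
    obtain ⟨hpK, hqK, hpM, hqM⟩ := hH
    refine ⟨hsep, DOne_of_adj hadj hsep, ?_, ?_⟩
    · intro hY
      rcases conn_d_of_hubY hY with hc | hc
      · exact hpK (mem_KH_triple.2 (Or.inr (Or.inr hc)))
      · exact hqK (mem_KH_triple.2 (Or.inr (Or.inr hc)))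
    · intro hW
      rcases conn_d_of_hubY hW with hc | hc
      · exact hpM (mem_MH_triple.2 (Or.inr (Or.inr hc)))
      · exact hqM (mem_MH_triple.2 (Or.inr (Or.inr hc)))

/-- On a `sepH` colouring of `{r, s, d}`, the `d`-avoiding colour preference of `p, q` is the
colour preference. -/
lemma sigma_endsD_eq_of_sepH {p q r s d : V} {ω : Config E}
    (h : sepH ends p q ({r, s, d} : Set V) ω) :
    sigma (endsD ends d) ω p q = sigma ends ω p q := by
  obtain ⟨hpK, _, hpM, _⟩ := h
  have h1 : ¬ Conn ends ω p d := fun hc => hpK (mem_KH_triple.2 (Or.inr (Or.inr (conn_symm hc))))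
  have h2 : ¬ Conn ends (OneColourSwitch.compl ω) p d :=
    fun hc => hpM (mem_MH_triple.2 (Or.inr (Or.inr (conn_symm hc))))
  have e1 : Conn (endsD ends d) ω p q ↔ Conn ends ω p q :=
    ⟨conn_of_conn_endsD, fun hc => conn_endsD_of_not_conn hc h1⟩
  have e2 : Conn (endsD ends d) (OneColourSwitch.compl ω) p q ↔
      Conn ends (OneColourSwitch.compl ω) p q :=
    ⟨conn_of_conn_endsD, fun hc => conn_endsD_of_not_conn hc h2⟩
  simp only [sigma, e1, e2]

end Triple

section Theorem

variable [Fintype V] [DecidableEq V] [Fintype E] [DecidableEq E]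

variable {ends : E → Sym2 V}

omit [Fintype V] [DecidableEq V] in
/-- **The hub-free region is the side-switch sum of the terminal set `{r, s, d}`.** -/
theorem regionL_eq_dzeroSignSumH {p q r s d : V}
    (hadj : ∀ x, Nonmark p q r s x → x ≠ d → ∃ e, ends e = s(x, p) ∨ ends e = s(x, q))
    (hpd : p ≠ d) (hqd : q ≠ d) :
    regionL ends p q r s d = dzeroSignSumH ends p q r s ({r, s, d} : Set V) := by
  unfold regionL dzeroSignSumH
  refine Finset.sum_congr rfl fun ω _ => ?_
  by_cases h : sepH ends p q ({r, s, d} : Set V) ω ∧ DZeroH ends ({r, s, d} : Set V) ω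
  · rw [if_pos ((hubfree_iff_sepH_dzeroH hadj hpd hqd).2 h), if_pos h, sigma_endsD_eq_of_sepH h.1]
  · rw [if_neg (fun h' => h ((hubfree_iff_sepH_dzeroH hadj hpd hqd).1 h')), if_neg h]

/-- **`regionL ≤ 0`.** -/
theorem regionL_nonpos {p q r s d : V}
    (hadj : ∀ x, Nonmark p q r s x → x ≠ d → ∃ e, ends e = s(x, p) ∨ ends e = s(x, q))
    (hpd : p ≠ d) (hqd : q ≠ d) : regionL ends p q r s d ≤ 0 := by
  rw [regionL_eq_dzeroSignSumH hadj hpd hqd]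
  exact dzeroSignSumH_nonpos_triple p q r s d

/-- **`T1 ≤ 0` on the single-`d` class with `d` on both terminals.** -/
theorem dSignSumAvoid_nonpos_of_singleD_pocket {p q r s d : V}
    (hadj : ∀ x, Nonmark p q r s x → x ≠ d → ∃ e, ends e = s(x, p) ∨ ends e = s(x, q))
    (hpd : p ≠ d) (hqd : q ≠ d) (hr : d ≠ r) (hs : d ≠ s) {er es : E} (her : ends er = s(d, r))
    (hes : ends es = s(d, s)) : dSignSumAvoid ends p q r s d ≤ 0 :=
  dSignSumAvoid_nonpos_of_regions p q r s d her hes (regionY_nonneg hadj hr hs hpd hqd her)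
    (regionL_nonpos hadj hpd hqd)

/-- **`dSignSum ≤ 0` on the single-`d` class with `d` on both terminals.** -/
theorem dSignSum_nonpos_of_singleD_pocket {p q r s d : V}
    (hadj : ∀ x, Nonmark p q r s x → x ≠ d → ∃ e, ends e = s(x, p) ∨ ends e = s(x, q))
    (hpd : p ≠ d) (hqd : q ≠ d) (hr : d ≠ r) (hs : d ≠ s) {er es : E} (her : ends er = s(d, r))
    (hes : ends es = s(d, s)) : dSignSum ends p q r s d ≤ 0 := by
  rw [dSignSum_eq_avoid_sub]
  have h1 := dSignSumAvoid_nonpos_of_singleD_pocket hadj hpd hqd hr hs her hes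
  have h2 := eWSum_nonneg_of_edges p q r s d her hes
  linarith

/-- **`m9` on the single-`d` class WITH a pocket**: if every non-mark other than `d` is adjacent
to `p` or `q`, and `d` is adjacent to `r` and to `s`, then `Σ_{Sep} σ_pq · σ_rs ≤ 0`. -/
theorem m9SignSum_nonpos_of_singleD_pocket {p q r s d : V}
    (hadj : ∀ x, Nonmark p q r s x → x ≠ d → ∃ e, ends e = s(x, p) ∨ ends e = s(x, q))
    (hpd : p ≠ d) (hqd : q ≠ d) (hr : d ≠ r) (hs : d ≠ s) {er es : E} (her : ends er = s(d, r))
    (hes : ends es = s(d, s)) : m9SignSum ends p q r s ≤ 0 := by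
  have h : m9SignSum ends p q r s = dSignSum ends p q r s d := by
    unfold m9SignSum dSignSum
    refine Finset.sum_congr rfl (fun ω _ => ?_)
    by_cases hsep : sep2 ends p q r s ω
    · simp [hsep, DOne_of_adj hadj hsep]
    · simp [hsep]
  rw [h]
  exact dSignSum_nonpos_of_singleD_pocket hadj hpd hqd hr hs her hes

end Theorem

end NoPocket

end Summit.Ventures.PercRepro2
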